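import Mathlib
import Summits.Ventures.HodgeRepro2.Tier7.Line3.HeckeWindowIdealOrb
import Summits.Ventures.HodgeRepro2.Tier7.Line3.HeckeWindowSix

/-!
# Tier7/Line3/HeckeWindowSixOrb — one of SIX fixed windows works, II: the order-4 recurrence of the model and THE THEOREM
(part VI = Tier7/Line3/HeckeWindowSix.lean: the abstract effective theorem; parts IV–V = HeckeWindowIdeal / HeckeWindowIdealOrb)

Filer: t7-L1-p3 (gen 7, prover-pub-hodge-repro2-t7-L1-p3-g7-0), self-selected on the seat's own TARGET line (STATUS
l. 15780; twin window held). Lane: Line 3 SUPPORT, [M]-level (a kernel fact about the §2c MODEL that the dictionary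
then quotes); NOT a line, NOT a device; touches neither residual clause (a′) nor (b′) of the line.

WHAT IT SUPPLIES. The model's orbital sums `o_n = orbSum(n,0)` (part II; the character summed over the `4n`-point solution
set of `inCartan_n_zero`) are, for `n ≥ 1`, the explicit FOUR-FAMILY SUM
  `famSum = β₂ⁿ T_{n+1}(α₂β₁) + β₁ⁿ T_{n+1}(α₂β₂) + α₂⁻ⁿ T_n(α₂β₂) + α₂⁻ⁿ T_n(α₂β₁) − (α₂β₁β₂)ⁿ − α₂⁻ⁿ`,
`T_n(x) = Σ_{j<n} xʲ` (`orbSum_eq_famSum`: `sol n 0 = solFinset n`, the two coincidences `m = ±n` of the four families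
subtracted once by `Finset.sum_union_inter`, the images re-indexed over `range`). Each piece satisfies a 2-term recurrence with
roots in `{β₁, β₂, α₂β₁β₂ = α₁⁻¹, α₂⁻¹}` (`geomT_rec`, `pow_rec2`), so `(o_n)_{n ≥ 1}` satisfies THE ORDER-4 RECURRENCE
`Rec4 β₁ β₂ (α₂β₁β₂) α₂⁻¹` (`famSum_rec4`, `rec4_orbSum`) — all four roots of modulus `1` for unitary data.
THE THEOREM (`exists_le_five_windowSeq_orbSum_ne_zero`): for every unitary `χ`, `‖c‖ = 1`, `0 < ‖κ‖ < 1`,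
`∃ n ≤ 5, W_n ≠ 0` — ONE OF THE SIX FIXED WINDOW FUNCTIONS `F_0, …, F_5` of part IV (each killing the pole class,
`satake_window_n`) has `O_{γ₀}(F_n) = vol · W_n ≠ 0`. Part IV's `∃ n` (a limit argument) is now a finite explicit list;
crit-2's record (c) of STATUS l. 15763 («`n` not effective») is discharged in the kernel.

NO TEMPEREDNESS AT `v₂` IS USED (plan-3 l. 15740 (4)): only unit-modulus `c`, `e = β₁β₂`, `β₁`, `β₂`, `α₁⁻¹`, `α₂⁻¹` enter.

NOT in this file (the dictionary, (a′), in words): Macdonald's formula `Ŝ(T_{(n,0)}) = P_n`, `Ŝ(1_{ϖK}·g) = αβ·Ŝ(g)`, the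
Cartan model (print), the identification of the real objects and the unitarity prints (as in parts IV–V); anything about
`X`; nothing about the step (P) is claimed.

§8(d) (uses an L-value-free non-vanishing device): NO — finite sums and polynomial identities.
-/

namespace Summit.Ventures.HodgeRepro2.Tier7.Line3.HeckeWindow

/-! ## K12. Geometric sums and the four families -/

/-- (K12) `T_n(x) = Σ_{j<n} xʲ`. -/
def geomT (x : ℂ) (n : ℕ) : ℂ := ∑ j ∈ Finset.range n, x ^ j

/-- `T_{n+1} = T_n + xⁿ`. -/
theorem geomT_succ (x : ℂ) (n : ℕ) : geomT x (n + 1) = geomT x n + x ^ n := Finset.sum_range_succ _ _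

/-- `T_{n+2} = (1 + x) T_{n+1} − x T_n`: the 2-term recurrence with roots `1, x`. -/
theorem geomT_rec (x : ℂ) (n : ℕ) : geomT x (n + 2) = (1 + x) * geomT x (n + 1) - x * geomT x n := by
  have h1 : geomT x (n + 2) = geomT x (n + 1) + x ^ (n + 1) := geomT_succ x (n + 1)
  have h0 := geomT_succ x n
  linear_combination h1 - x * h0

/-- (K12) The four-family form of `o_n` (`n ≥ 1`):
`β₂ⁿ T_{n+1}(α₂β₁) + β₁ⁿ T_{n+1}(α₂β₂) + α₂⁻ⁿ T_n(α₂β₂) + α₂⁻ⁿ T_n(α₂β₁) − (α₂β₁β₂)ⁿ − α₂⁻ⁿ`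
(`A = α₂`, `b₁ = β₁`, `b₂ = β₂`). -/
noncomputable def famSum (A b₁ b₂ : ℂ) (n : ℕ) : ℂ :=
  b₂ ^ n * geomT (A * b₁) (n + 1) + b₁ ^ n * geomT (A * b₂) (n + 1) +
    A⁻¹ ^ n * geomT (A * b₂) n + A⁻¹ ^ n * geomT (A * b₁) n - (A * b₁ * b₂) ^ n - A⁻¹ ^ n

/-- The first family `{(m, m, n) : 0 ≤ m ≤ n}`. -/
noncomputable def fam1 (n : ℕ) : Finset (ℤ × ℤ × ℤ) :=
  (Finset.Icc (0 : ℤ) n).image fun m : ℤ => (m, m, (n : ℤ))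

/-- The second family `{(m, n, m) : 0 ≤ m ≤ n}`. -/
noncomputable def fam2 (n : ℕ) : Finset (ℤ × ℤ × ℤ) :=
  (Finset.Icc (0 : ℤ) n).image fun m : ℤ => (m, (n : ℤ), m)

/-- The third family `{(m, 0, m + n) : −n ≤ m < 0}`. -/
noncomputable def fam3 (n : ℕ) : Finset (ℤ × ℤ × ℤ) :=
  (Finset.Ico (-(n : ℤ)) 0).image fun m : ℤ => (m, (0 : ℤ), m + (n : ℤ))

/-- The fourth family `{(m, m + n, 0) : −n ≤ m < 0}`. -/
noncomputable def fam4 (n : ℕ) : Finset (ℤ × ℤ × ℤ) :=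
  (Finset.Ico (-(n : ℤ)) 0).image fun m : ℤ => (m, m + (n : ℤ), (0 : ℤ))

/-- `solFinset n` is the union of the four families. -/
theorem solFinset_eq (n : ℕ) : solFinset n = (fam1 n ∪ fam2 n) ∪ (fam3 n ∪ fam4 n) := rfl

/-- (K12) `sol n 0 = solFinset n` (both inclusions). -/
theorem sol_n_zero_eq_solFinset (n : ℕ) : sol (n : ℤ) 0 = ↑(solFinset n) := by
  refine Set.Subset.antisymm (sol_subset_solFinset n) ?_
  rintro ⟨m, x, y⟩ hp
  rw [Finset.mem_coe] at hp
  simp only [solFinset, Finset.mem_union, Finset.mem_image, Finset.mem_Icc, Finset.mem_Ico,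
    Prod.mk.injEq] at hp
  show InCartan (n : ℤ) 0 0 m x y
  rw [inCartan_n_zero (n : ℤ) (by positivity)]
  rcases hp with (⟨a, ⟨h0, hn⟩, rfl, rfl, rfl⟩ | ⟨a, ⟨h0, hn⟩, rfl, rfl, rfl⟩) |
    (⟨a, ⟨h0, hn⟩, rfl, rfl, rfl⟩ | ⟨a, ⟨h0, hn⟩, rfl, rfl, rfl⟩)
  · exact Or.inl ⟨h0, hn, Or.inl ⟨rfl, rfl⟩⟩
  · exact Or.inl ⟨h0, hn, Or.inr ⟨rfl, rfl⟩⟩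
  · exact Or.inr ⟨h0, hn, Or.inl ⟨rfl, rfl⟩⟩
  · exact Or.inr ⟨h0, hn, Or.inr ⟨rfl, rfl⟩⟩

/-- `Icc 0 n` over `ℤ` is the image of `range (n+1)`. -/
theorem Icc_eq_image_range (n : ℕ) :
    Finset.Icc (0 : ℤ) n = (Finset.range (n + 1)).image fun k : ℕ => (k : ℤ) := by
  ext m
  simp only [Finset.mem_Icc, Finset.mem_image, Finset.mem_range]
  constructor
  · rintro ⟨h1, h2⟩
    refine ⟨m.toNat, ?_, Int.toNat_of_nonneg h1⟩
    have := Int.toNat_of_nonneg h1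
    omega
  · rintro ⟨k, hk, rfl⟩
    omega

/-- `Ico (−n) 0` over `ℤ` is the image of `range n` under `k ↦ k − n`. -/
theorem Ico_eq_image_range (n : ℕ) :
    Finset.Ico (-(n : ℤ)) 0 = (Finset.range n).image fun k : ℕ => (k : ℤ) - n := by
  ext m
  simp only [Finset.mem_Ico, Finset.mem_image, Finset.mem_range]
  constructor
  · rintro ⟨h1, h2⟩
    have h3 : 0 ≤ m + n := by omega
    refine ⟨(m + n).toNat, ?_, ?_⟩
    · have := Int.toNat_of_nonneg h3
      omega
    · rw [Int.toNat_of_nonneg h3]; ring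
  · rintro ⟨k, hk, rfl⟩
    omega

/-- (K12) The first family sums to `β₂ⁿ T_{n+1}(α₂β₁)`. -/
theorem sum_fam1 (χ : UnramChar) (n : ℕ) :
    ∑ p ∈ fam1 n, χ.val₀ p = χ.β₂ ^ n * geomT (χ.α₂ * χ.β₁) (n + 1) := by
  unfold fam1
  rw [Finset.sum_image (by intro a _ b _ h; simpa using h), Icc_eq_image_range,
    Finset.sum_image (by intro a _ b _ h; simpa using h)]
  unfold geomT
  rw [Finset.mul_sum]
  refine Finset.sum_congr rfl fun k _ => ?_
  simp only [UnramChar.val₀, UnramChar.val, zpow_zero, one_mul, zpow_natCast]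
  ring

/-- (K12) The second family sums to `β₁ⁿ T_{n+1}(α₂β₂)`. -/
theorem sum_fam2 (χ : UnramChar) (n : ℕ) :
    ∑ p ∈ fam2 n, χ.val₀ p = χ.β₁ ^ n * geomT (χ.α₂ * χ.β₂) (n + 1) := by
  unfold fam2
  rw [Finset.sum_image (by intro a _ b _ h; simpa using h), Icc_eq_image_range,
    Finset.sum_image (by intro a _ b _ h; simpa using h)]
  unfold geomT
  rw [Finset.mul_sum]
  refine Finset.sum_congr rfl fun k _ => ?_
  simp only [UnramChar.val₀, UnramChar.val, zpow_zero, one_mul, zpow_natCast]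
  ring

/-- (K12) The third family sums to `α₂⁻ⁿ T_n(α₂β₂)`. -/
theorem sum_fam3 (χ : UnramChar) (n : ℕ) :
    ∑ p ∈ fam3 n, χ.val₀ p = χ.α₂⁻¹ ^ n * geomT (χ.α₂ * χ.β₂) n := by
  unfold fam3
  rw [Finset.sum_image (by intro a _ b _ h; simpa using h), Ico_eq_image_range,
    Finset.sum_image (by intro a _ b _ h; simp only at h; omega)]
  unfold geomT
  rw [Finset.mul_sum]
  refine Finset.sum_congr rfl fun k _ => ?_
  simp only [UnramChar.val₀, UnramChar.val, zpow_zero, one_mul, mul_one, sub_add_cancel,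
    zpow_natCast]
  rw [zpow_sub₀ χ.α₂_ne_zero, zpow_natCast, zpow_natCast, div_eq_mul_inv, ← inv_pow]
  ring

/-- (K12) The fourth family sums to `α₂⁻ⁿ T_n(α₂β₁)`. -/
theorem sum_fam4 (χ : UnramChar) (n : ℕ) :
    ∑ p ∈ fam4 n, χ.val₀ p = χ.α₂⁻¹ ^ n * geomT (χ.α₂ * χ.β₁) n := by
  unfold fam4
  rw [Finset.sum_image (by intro a _ b _ h; simpa using h), Ico_eq_image_range,
    Finset.sum_image (by intro a _ b _ h; simp only at h; omega)]
  unfold geomT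
  rw [Finset.mul_sum]
  refine Finset.sum_congr rfl fun k _ => ?_
  simp only [UnramChar.val₀, UnramChar.val, zpow_zero, one_mul, mul_one, sub_add_cancel,
    zpow_natCast]
  rw [zpow_sub₀ χ.α₂_ne_zero, zpow_natCast, zpow_natCast, div_eq_mul_inv, ← inv_pow]
  ring

/-- The first two families meet exactly in `(n, n, n)`. -/
theorem fam1_inter_fam2 (n : ℕ) : fam1 n ∩ fam2 n = {((n : ℤ), (n : ℤ), (n : ℤ))} := by
  ext ⟨m, x, y⟩
  simp only [fam1, fam2, Finset.mem_inter, Finset.mem_image, Finset.mem_Icc, Finset.mem_singleton,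
    Prod.mk.injEq]
  constructor
  · rintro ⟨⟨a, ⟨h0, hn⟩, rfl, rfl, rfl⟩, ⟨b, ⟨h0', hn'⟩, hb1, hb2, hb3⟩⟩
    omega
  · rintro ⟨rfl, rfl, rfl⟩
    exact ⟨⟨(n : ℤ), ⟨by positivity, le_refl _⟩, rfl, rfl, rfl⟩,
      ⟨(n : ℤ), ⟨by positivity, le_refl _⟩, rfl, rfl, rfl⟩⟩

/-- The last two families meet exactly in `(−n, 0, 0)` (`n ≥ 1`). -/
theorem fam3_inter_fam4 (n : ℕ) (hn : 1 ≤ n) : fam3 n ∩ fam4 n = {(-(n : ℤ), (0 : ℤ), (0 : ℤ))} := by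
  ext ⟨m, x, y⟩
  simp only [fam3, fam4, Finset.mem_inter, Finset.mem_image, Finset.mem_Ico, Finset.mem_singleton,
    Prod.mk.injEq]
  constructor
  · rintro ⟨⟨a, ⟨h0, hn'⟩, rfl, rfl, rfl⟩, ⟨b, ⟨h0', hn''⟩, hb1, hb2, hb3⟩⟩
    omega
  · rintro ⟨rfl, rfl, rfl⟩
    exact ⟨⟨-(n : ℤ), ⟨le_refl _, by omega⟩, rfl, rfl, by ring⟩,
      ⟨-(n : ℤ), ⟨le_refl _, by omega⟩, rfl, by ring, rfl⟩⟩

/-- The non-negative and the negative families are disjoint. -/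
theorem disjoint_fam (n : ℕ) : Disjoint (fam1 n ∪ fam2 n) (fam3 n ∪ fam4 n) := by
  rw [Finset.disjoint_left]
  rintro ⟨m, x, y⟩ hp hq
  simp only [fam1, fam2, fam3, fam4, Finset.mem_union, Finset.mem_image, Finset.mem_Icc,
    Finset.mem_Ico, Prod.mk.injEq] at hp hq
  rcases hp with ⟨a, ⟨h0, _⟩, rfl, _, _⟩ | ⟨a, ⟨h0, _⟩, rfl, _, _⟩ <;>
    rcases hq with ⟨b, ⟨_, hb⟩, hb1, _, _⟩ | ⟨b, ⟨_, hb⟩, hb1, _, _⟩ <;> omega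

/-- (K12) THE FOUR-FAMILY FORM: `orbSum(n, 0) = famSum n` for `n ≥ 1`. -/
theorem orbSum_eq_famSum (χ : UnramChar) (n : ℕ) (hn : 1 ≤ n) :
    orbSum χ (n : ℤ) 0 = famSum χ.α₂ χ.β₁ χ.β₂ n := by
  unfold orbSum
  rw [sol_n_zero_eq_solFinset, finsum_mem_coe_finset, solFinset_eq, Finset.sum_union (disjoint_fam n)]
  have h12 := Finset.sum_union_inter (s₁ := fam1 n) (s₂ := fam2 n) (f := χ.val₀)
  have h34 := Finset.sum_union_inter (s₁ := fam3 n) (s₂ := fam4 n) (f := χ.val₀)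
  rw [fam1_inter_fam2, Finset.sum_singleton, sum_fam1, sum_fam2] at h12
  rw [fam3_inter_fam4 n hn, Finset.sum_singleton, sum_fam3, sum_fam4] at h34
  have hv1 : χ.val₀ ((n : ℤ), (n : ℤ), (n : ℤ)) = (χ.α₂ * χ.β₁ * χ.β₂) ^ n := by
    simp only [UnramChar.val₀, UnramChar.val, zpow_zero, one_mul, zpow_natCast]
    ring
  have hv2 : χ.val₀ (-(n : ℤ), (0 : ℤ), (0 : ℤ)) = χ.α₂⁻¹ ^ n := by
    simp only [UnramChar.val₀, UnramChar.val, zpow_zero, one_mul, mul_one, zpow_neg, zpow_natCast,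
      inv_pow]
  rw [hv1] at h12
  rw [hv2] at h34
  unfold famSum
  linear_combination h12 + h34

/-! ## K13. The order-4 recurrence of the model -/

/-- (K13) `famSum` satisfies the order-4 recurrence with roots `β₁, β₂, α₂β₁β₂, α₂⁻¹`. -/
theorem famSum_rec4 (A b₁ b₂ : ℂ) (hA : A ≠ 0) :
    Rec4 b₁ b₂ (A * b₁ * b₂) A⁻¹ (famSum A b₁ b₂) 0 := by
  have hA' : A⁻¹ * A = 1 := inv_mul_cancel₀ hA
  have hp1 : Rec4 b₁ b₂ (A * b₁ * b₂) A⁻¹ (fun n => b₂ ^ n * geomT (A * b₁) (n + 1)) 0 :=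
    (rec4_of_rec2 b₂ (A * b₁ * b₂) b₁ A⁻¹ _ (fun n => by
      show b₂ ^ (n + 2) * geomT (A * b₁) (n + 3) =
        (b₂ + A * b₁ * b₂) * (b₂ ^ (n + 1) * geomT (A * b₁) (n + 2)) -
          b₂ * (A * b₁ * b₂) * (b₂ ^ n * geomT (A * b₁) (n + 1))
      have h : geomT (A * b₁) (n + 3) =
          (1 + A * b₁) * geomT (A * b₁) (n + 2) - A * b₁ * geomT (A * b₁) (n + 1) :=
        geomT_rec (A * b₁) (n + 1)
      linear_combination (b₂ ^ (n + 2)) * h)).of_esym_eq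
      (by simp only [esym1]; ring) (by simp only [esym2]; ring) (by simp only [esym3]; ring)
      (by simp only [esym4]; ring)
  have hp2 : Rec4 b₁ b₂ (A * b₁ * b₂) A⁻¹ (fun n => b₁ ^ n * geomT (A * b₂) (n + 1)) 0 :=
    (rec4_of_rec2 b₁ (A * b₁ * b₂) b₂ A⁻¹ _ (fun n => by
      show b₁ ^ (n + 2) * geomT (A * b₂) (n + 3) =
        (b₁ + A * b₁ * b₂) * (b₁ ^ (n + 1) * geomT (A * b₂) (n + 2)) -
          b₁ * (A * b₁ * b₂) * (b₁ ^ n * geomT (A * b₂) (n + 1))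
      have h : geomT (A * b₂) (n + 3) =
          (1 + A * b₂) * geomT (A * b₂) (n + 2) - A * b₂ * geomT (A * b₂) (n + 1) :=
        geomT_rec (A * b₂) (n + 1)
      linear_combination (b₁ ^ (n + 2)) * h)).of_esym_eq
      (by simp only [esym1]; ring) (by simp only [esym2]; ring) (by simp only [esym3]; ring)
      (by simp only [esym4]; ring)
  have hp3 : Rec4 b₁ b₂ (A * b₁ * b₂) A⁻¹ (fun n => A⁻¹ ^ n * geomT (A * b₂) n) 0 :=
    (rec4_of_rec2 A⁻¹ b₂ b₁ (A * b₁ * b₂) _ (fun n => by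
      show A⁻¹ ^ (n + 2) * geomT (A * b₂) (n + 2) =
        (A⁻¹ + b₂) * (A⁻¹ ^ (n + 1) * geomT (A * b₂) (n + 1)) -
          A⁻¹ * b₂ * (A⁻¹ ^ n * geomT (A * b₂) n)
      have h := geomT_rec (A * b₂) n
      linear_combination (A⁻¹ ^ (n + 2)) * h +
        (b₂ * A⁻¹ ^ (n + 1) * (geomT (A * b₂) (n + 1) - geomT (A * b₂) n)) * hA')).of_esym_eq
      (by simp only [esym1]; ring) (by simp only [esym2]; ring) (by simp only [esym3]; ring)
      (by simp only [esym4]; ring)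
  have hp4 : Rec4 b₁ b₂ (A * b₁ * b₂) A⁻¹ (fun n => A⁻¹ ^ n * geomT (A * b₁) n) 0 :=
    (rec4_of_rec2 A⁻¹ b₁ b₂ (A * b₁ * b₂) _ (fun n => by
      show A⁻¹ ^ (n + 2) * geomT (A * b₁) (n + 2) =
        (A⁻¹ + b₁) * (A⁻¹ ^ (n + 1) * geomT (A * b₁) (n + 1)) -
          A⁻¹ * b₁ * (A⁻¹ ^ n * geomT (A * b₁) n)
      have h := geomT_rec (A * b₁) n
      linear_combination (A⁻¹ ^ (n + 2)) * h +
        (b₁ * A⁻¹ ^ (n + 1) * (geomT (A * b₁) (n + 1) - geomT (A * b₁) n)) * hA')).of_esym_eq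
      (by simp only [esym1]; ring) (by simp only [esym2]; ring) (by simp only [esym3]; ring)
      (by simp only [esym4]; ring)
  have hp5 : Rec4 b₁ b₂ (A * b₁ * b₂) A⁻¹ (fun n => (A * b₁ * b₂) ^ n) 0 :=
    (rec4_of_rec2 (A * b₁ * b₂) b₁ b₂ A⁻¹ _ (fun n => pow_rec2 _ _ n)).of_esym_eq
      (by simp only [esym1]; ring) (by simp only [esym2]; ring) (by simp only [esym3]; ring)
      (by simp only [esym4]; ring)
  have hp6 : Rec4 b₁ b₂ (A * b₁ * b₂) A⁻¹ (fun n => A⁻¹ ^ n) 0 :=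
    (rec4_of_rec2 A⁻¹ b₁ b₂ (A * b₁ * b₂) _ (fun n => pow_rec2 _ _ n)).of_esym_eq
      (by simp only [esym1]; ring) (by simp only [esym2]; ring) (by simp only [esym3]; ring)
      (by simp only [esym4]; ring)
  exact Rec4.of_eventually_eq (((((hp1.add hp2).add hp3).add hp4).sub hp5).sub hp6) fun n _ => rfl

/-- (K13) THE MODEL'S RECURRENCE: `(orbSum(n,0))_{n ≥ 1}` satisfies `Rec4 β₁ β₂ (α₂β₁β₂) α₂⁻¹`. -/
theorem rec4_orbSum (χ : UnramChar) :
    Rec4 χ.β₁ χ.β₂ (χ.α₂ * χ.β₁ * χ.β₂) χ.α₂⁻¹ (fun n : ℕ => orbSum χ (n : ℤ) 0) 1 :=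
  Rec4.of_eventually_eq (fun n _ => famSum_rec4 χ.α₂ χ.β₁ χ.β₂ χ.α₂_ne_zero n (Nat.zero_le n))
    fun n hn => orbSum_eq_famSum χ n hn

/-! ## K14. THE THEOREM: one of the six fixed windows works at every split place -/

/-- (K14) ONE OF SIX FIXED WINDOWS WORKS. For every unitary unramified datum `χ`, every `‖c‖ = 1` and `0 < ‖κ‖ < 1`,
one of `W_0, …, W_5` is non-zero — i.e. one of the six fixed Hecke functions `F_0, …, F_5` of part IV (each with
`Ŝ(F_n) = (α − c)(β − c) P_n`, killing the pole class) has `O_{γ₀}(F_n) = vol · W_n ≠ 0`. -/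
theorem exists_le_five_windowSeq_orbSum_ne_zero (χ : UnramChar) (hχ : χ.Unitary) (c κ : ℂ)
    (hc : ‖c‖ = 1) (hκ0 : κ ≠ 0) (hκ : ‖κ‖ < 1) :
    ∃ n, n ≤ 5 ∧ windowSeq (fun n : ℕ => orbSum χ (n : ℤ) 0) (χ.β₁ * χ.β₂) c κ n ≠ 0 := by
  obtain ⟨_, h2, h3, h4⟩ := hχ
  have he : ‖χ.β₁ * χ.β₂‖ = 1 := by rw [norm_mul, h3, h4, mul_one]
  have hρ₃ : ‖χ.α₂ * χ.β₁ * χ.β₂‖ = 1 := by rw [norm_mul, norm_mul, h2, h3, h4]; norm_num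
  have hρ₄ : ‖χ.α₂⁻¹‖ = 1 := by rw [norm_inv, h2, inv_one]
  exact exists_le_five_windowSeq_ne_zero _ _ c κ _ _ _ _ (by simpa using orbSum_zero_zero χ)
    (rec4_orbSum χ) h3 h4 hρ₃ hρ₄ he hc hκ0 hκ

/-- (K14) The same with `vol ≠ 0`: `∃ n ≤ 5, vol · W_n ≠ 0`. -/
theorem exists_le_five_vol_mul_windowSeq_ne_zero (χ : UnramChar) (hχ : χ.Unitary) (c κ : ℂ)
    (hc : ‖c‖ = 1) (hκ0 : κ ≠ 0) (hκ : ‖κ‖ < 1) (vol : ℂ) (hvol : vol ≠ 0) :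
    ∃ n, n ≤ 5 ∧ vol * windowSeq (fun n : ℕ => orbSum χ (n : ℤ) 0) (χ.β₁ * χ.β₂) c κ n ≠ 0 := by
  obtain ⟨n, hn, h⟩ := exists_le_five_windowSeq_orbSum_ne_zero χ hχ c κ hc hκ0 hκ
  exact ⟨n, hn, mul_ne_zero hvol h⟩

end Summit.Ventures.HodgeRepro2.Tier7.Line3.HeckeWindow
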